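/-
COR-CM (cell pub-hodgecm2, stage 2 of the Hodge ladder) — count-neutral KERNEL COMBINATORICS «order 16: the quaternion doublings `Q₈ × ℤ/2` and
`Q₈ ∘ ℤ/4` (Pauli)», part III: WORDS and the DICTIONARY (seat prover-pub-hodgecm2-b23-g54-0, binder prover b23, gen 54; claim HOME/INBOX.md l.25095).
Bookkeeping definitions with bodies (`xk`, `word`, `wordG`, `ty`, `typeSetOf`, `typeOf`, `typeEquiv`) + theorems on parts I–II BY NAME — seat b23
gen 53ʼs `Census/BinaryTetrahedral{Words,Dictionary}.lean` for the words `cᵉ r_v` of a quaternion doubling; no `decide` beyond closed identities in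
`ZMod 2`/`Fin 8`, no certificate, no named fact, no `sorry`.  `Interfaces.lean` (C1), every E term, B01, `Transposition/*`, `PortJoin/*`,
`D2Bridge/*` untouched.
HONEST FRAMING: `HC_CM` is NOT proved, here or anywhere in the tree; nothing here is a period, a count of record or a headline.
T5: n/a-class (hypothesis binders = the fields of `QuaternionDoubling.Datum`); checker: self.
-/
import Summits.HodgeConjecture.CorCM.Census.QuaternionDoublingCore
import Summits.HodgeConjecture.CorCM.Census.QuaternionDoublingModel
import Summits.HodgeConjecture.CorCM.Census.CoinvariantFibre

/-!
# The quaternion doublings, III: words `cᵉ r_v` and the dictionary `CMF G c ≃ (Fin 8 → ℤ/2)`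

Along a quaternion doubling datum `D : Datum G c τ`:
* §1 **Words.**  The place representatives `r = (1, i, j, ij, x, ix, jx, ijx)` (`xk D : Fin 8 → G`) and the words `word e v = cᵉ r_v`; right
  multiplication by the generators moves words by the tables of part I: `word e v · i = word (e + mI τ v) (πI v)`, `· j` likewise,
  `word e v · x = word e (πX v)`, `word e v · c = word (e + 1) v` (`word_mul_i/j/x/c`); every element is uniquely a word (`wordEquiv : ℤ/2 × Fin 8 ≃ G`);
  places: `word e' v' ∈ {word e v, c·word e v} ↔ v' = v`.
* §2 **The dictionary** `ty Ψ v = [word 0 v ∉ Ψ]` (`word e v ∈ Ψ ↔ ty Ψ v = e`), `typeOf`, `typeEquiv : CMF G c ≃ Lab`.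
* §3 **Base changes are the motions**: `ty (Ψ·i⁻¹) = μI τ (ty Ψ)`, `ty (Ψ·j⁻¹) = μJ τ (ty Ψ)`, `ty (Ψ·x⁻¹) = μX (ty Ψ)`, `ty (Ψ·c) = μC (ty Ψ)`, and for the
  word `wordG w = cᵉ iᵃ jᵇ xᵈ` (`w = e + 2a + 4b + 8d`): `ty (Ψ·(wordG w)⁻¹) = Motw τ w (ty Ψ)`.
* §4 **Flips**: `ty (Φ^{(word e v)}) = flipAt v (ty Φ)`.
(Part VI §0 transports vectors: `T = (ty)_*`.)
All [folklore] (Pohlmannʼs dictionary [Pohlmann1968, Thm 1] on the cosets of `⟨c⟩`).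

## References
* [Pohlmann1968] H. Pohlmann, Algebraic cycles on abelian varieties of complex multiplication type, Ann. of Math. 88 (1968), Thm 1.
-/

namespace Summit.HodgeConjecture.CorCM.Census.QuaternionDoubling

open Finset
open Summit.HodgeConjecture.CorCM.Prior.AllgGroup.RfwfAllgGroup
open Summit.HodgeConjecture.CorCM.Census.BlockParity
open Summit.HodgeConjecture.CorCM.Census.Coinvariant

noncomputable section

variable {G : Type*} [Group G] [Fintype G] [DecidableEq G] {c : G} {τ : ZMod 2} (D : Datum G c τ)

/-! ## §1 Words -/

/-- **The place representatives** `r = (1, i, j, ij, x, ix, jx, ijx)`. [folklore] -/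
def xk (v : Fin 8) : G := (![1, D.i, D.j, D.i * D.j, D.x, D.i * D.x, D.j * D.x, D.i * D.j * D.x] : Fin 8 → G) v

/-- **The word** `cᵉ r_v`. [folklore] -/
def word (e : ZMod 2) (v : Fin 8) : G := cpow c e * xk D v

omit [Fintype G] [DecidableEq G] in
include D in
/-- `cˢ·cᵗ = cˢ⁺ᵗ`. [folklore] -/
theorem cpow_mul_cpow' (s t : ZMod 2) : cpow c s * cpow c t = cpow c (s + t) := by
  have hs : ∀ z : ZMod 2, z = 0 ∨ z = 1 := by decide
  rcases hs s with rfl | rfl <;> rcases hs t with rfl | rfl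
  · simp [cpow]
  · simp [cpow]
  · simp [cpow]
  · simp only [cpow, one_ne_zero, if_false, show (1 : ZMod 2) + 1 = 0 by decide, if_true]; exact D.c_mul_c

omit [Fintype G] [DecidableEq G] in
include D in
/-- `c·cᵗ = cᵗ⁺¹`. [folklore] -/
theorem c_mul_cpow (t : ZMod 2) : c * cpow c t = cpow c (t + 1) := by
  have hs : ∀ z : ZMod 2, z = 0 ∨ z = 1 := by decide
  rcases hs t with rfl | rfl
  · simp [cpow]
  · simp only [cpow, one_ne_zero, if_false, show (1 : ZMod 2) + 1 = 0 by decide, if_true]; exact D.c_mul_c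

omit [Fintype G] [DecidableEq G] in
include D in
/-- `cᵗ·c = cᵗ⁺¹`. [folklore] -/
theorem cpow_mul_c (t : ZMod 2) : cpow c t * c = cpow c (t + 1) := by
  rw [cpow_comm_c, c_mul_cpow D]
where
  /-- `cᵗ` commutes with `c`. [folklore] -/
  cpow_comm_c : cpow c t * c = c * cpow c t := by unfold cpow; split_ifs <;> simp

omit [DecidableEq G] in
include D in
/-- `cᵗ` is central. [folklore] -/
theorem cpow_comm (t : ZMod 2) (g : G) : cpow c t * g = g * cpow c t := by
  unfold cpow; split_ifs
  · rw [one_mul, mul_one]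
  · exact ((Subgroup.mem_center_iff.mp D.c_mem_center) g).symm

omit [Fintype G] [DecidableEq G] in
/-- **`c · word = word` with `e + 1`.** [folklore] -/
theorem c_mul_word (e : ZMod 2) (v : Fin 8) : c * word D e v = word D (e + 1) v := by
  simp only [word, ← mul_assoc, c_mul_cpow D]

omit [DecidableEq G] in
/-- **`word · c = word` with `e + 1`.** [folklore] -/
theorem word_mul_c (e : ZMod 2) (v : Fin 8) : word D e v * c = word D (e + 1) v := by
  rw [(Subgroup.mem_center_iff.mp D.c_mem_center), c_mul_word]

omit [Fintype G] [DecidableEq G] in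
/-- `r_v · x = r_{πX v}` (the cosets swap; `x² = 1`). [folklore] -/
theorem xk_mul_x (v : Fin 8) : xk D v * D.x = xk D (πX v) := by
  fin_cases v
  · show 1 * D.x = D.x; rw [one_mul]
  · show D.i * D.x = D.i * D.x; rfl
  · show D.j * D.x = D.j * D.x; rfl
  · show D.i * D.j * D.x = D.i * D.j * D.x; rfl
  · show D.x * D.x = 1; exact D.hxx
  · show D.i * D.x * D.x = D.i; rw [mul_assoc, D.hxx, mul_one]
  · show D.j * D.x * D.x = D.j; rw [mul_assoc, D.hxx, mul_one]
  · show D.i * D.j * D.x * D.x = D.i * D.j; rw [mul_assoc, D.hxx, mul_one]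

omit [DecidableEq G] in
/-- `r_v · i = c^{mI τ v} r_{πI v}`. [folklore] -/
theorem xk_mul_i (v : Fin 8) : xk D v * D.i = cpow c (mI τ v) * xk D (πI v) := by
  have e3 : D.i * D.j * D.i = D.j := D.i_mul_j_mul_i
  have hc1 : cpow c 1 = c := by simp [cpow]
  have hxi : D.x * D.i = cpow c τ * D.i * D.x := D.x_mul_i
  fin_cases v
  · show 1 * D.i = cpow c 0 * D.i; simp [cpow]
  · show D.i * D.i = cpow c 1 * 1; rw [hc1, mul_one, D.hii]
  · show D.j * D.i = cpow c 1 * (D.i * D.j); rw [hc1, D.j_mul_i, mul_assoc]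
  · show D.i * D.j * D.i = cpow c 0 * D.j; rw [e3]; simp [cpow]
  · show D.x * D.i = cpow c τ * (D.i * D.x); rw [hxi, mul_assoc]
  · show D.i * D.x * D.i = cpow c (1 + τ) * D.x
    rw [mul_assoc, hxi, ← mul_assoc, ← mul_assoc, ← cpow_comm D τ D.i, mul_assoc (cpow c τ), D.hii, cpow_mul_c D, add_comm]
  · show D.j * D.x * D.i = cpow c (1 + τ) * (D.i * D.j * D.x)
    rw [mul_assoc, hxi, ← mul_assoc, ← mul_assoc, ← cpow_comm D τ D.j, mul_assoc (cpow c τ), D.j_mul_i,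
      show cpow c τ * (c * D.i * D.j) * D.x = cpow c τ * c * (D.i * D.j * D.x) by group, cpow_mul_c D, add_comm]
  · show D.i * D.j * D.x * D.i = cpow c τ * (D.j * D.x)
    rw [mul_assoc, hxi, ← mul_assoc, ← mul_assoc, ← cpow_comm D τ (D.i * D.j), mul_assoc (cpow c τ), e3, mul_assoc]

omit [DecidableEq G] in
/-- `r_v · j = c^{mJ τ v} r_{πJ v}`. [folklore] -/
theorem xk_mul_j (v : Fin 8) : xk D v * D.j = cpow c (mJ τ v) * xk D (πJ v) := by
  have hc1 : cpow c 1 = c := by simp [cpow]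
  have hxj : D.x * D.j = cpow c τ * D.j * D.x := D.x_mul_j
  have e3 : D.i * D.j * D.j = c * D.i := by rw [mul_assoc, D.hjj, D.commute_i_c.eq]
  fin_cases v
  · show 1 * D.j = cpow c 0 * D.j; simp [cpow]
  · show D.i * D.j = cpow c 0 * (D.i * D.j); simp [cpow]
  · show D.j * D.j = cpow c 1 * 1; rw [hc1, mul_one, D.hjj]
  · show D.i * D.j * D.j = cpow c 1 * D.i; rw [hc1, e3]
  · show D.x * D.j = cpow c τ * (D.j * D.x); rw [hxj, mul_assoc]
  · show D.i * D.x * D.j = cpow c τ * (D.i * D.j * D.x)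
    rw [mul_assoc, hxj, ← mul_assoc, ← mul_assoc, ← cpow_comm D τ D.i]; group
  · show D.j * D.x * D.j = cpow c (1 + τ) * D.x
    rw [mul_assoc, hxj, ← mul_assoc, ← mul_assoc, ← cpow_comm D τ D.j, mul_assoc (cpow c τ), D.hjj, cpow_mul_c D, add_comm]
  · show D.i * D.j * D.x * D.j = cpow c (1 + τ) * (D.i * D.x)
    rw [mul_assoc, hxj, ← mul_assoc, ← mul_assoc, ← cpow_comm D τ (D.i * D.j), mul_assoc (cpow c τ), e3,
      show cpow c τ * (c * D.i) * D.x = cpow c τ * c * (D.i * D.x) by group, cpow_mul_c D, add_comm]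

omit [DecidableEq G] in
/-- **`word · i`**: place `πI v`, mask `mI τ v`. [folklore] -/
theorem word_mul_i (e : ZMod 2) (v : Fin 8) : word D e v * D.i = word D (e + mI τ v) (πI v) := by
  simp only [word]
  rw [mul_assoc, xk_mul_i, ← mul_assoc, cpow_mul_cpow' D]

omit [DecidableEq G] in
/-- **`word · j`**: place `πJ v`, mask `mJ τ v`. [folklore] -/
theorem word_mul_j (e : ZMod 2) (v : Fin 8) : word D e v * D.j = word D (e + mJ τ v) (πJ v) := by
  simp only [word]
  rw [mul_assoc, xk_mul_j, ← mul_assoc, cpow_mul_cpow' D]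

omit [Fintype G] [DecidableEq G] in
/-- **`word · x`**: place `πX v`, no mask. [folklore] -/
theorem word_mul_x (e : ZMod 2) (v : Fin 8) : word D e v * D.x = word D e (πX v) := by
  simp only [word]
  rw [mul_assoc, xk_mul_x]

omit [Fintype G] [DecidableEq G] in
/-- The normal forms `iᵘ jᵛ xᵈ` are words. [folklore] -/
theorem exists_word_eq (u v d : ℕ) (hu : u < 4) (hv : v < 2) (hd : d < 2) : ∃ (e : ZMod 2) (w : Fin 8), D.i ^ u * D.j ^ v * D.x ^ d = word D e w := by
  have hc1 : cpow c 1 = c := by simp [cpow]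
  have hi2 : D.i ^ 2 = c := by rw [pow_two, D.hii]
  have hi3 : D.i ^ 3 = c * D.i := by rw [pow_succ, hi2]
  interval_cases u <;> interval_cases v <;> interval_cases d
  · exact ⟨0, 0, by simp [word, xk, cpow]⟩
  · exact ⟨0, 4, by simp [word, xk, cpow]⟩
  · exact ⟨0, 2, by simp [word, xk, cpow]⟩
  · exact ⟨0, 6, by simp [word, xk, cpow]⟩
  · exact ⟨0, 1, by simp [word, xk, cpow]⟩
  · exact ⟨0, 5, by simp [word, xk, cpow]⟩
  · exact ⟨0, 3, by simp [word, xk, cpow]⟩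
  · exact ⟨0, 7, by simp [word, xk, cpow, mul_assoc]⟩
  · exact ⟨1, 0, by simp [word, xk, hc1, hi2]⟩
  · exact ⟨1, 4, by simp [word, xk, hc1, hi2]⟩
  · exact ⟨1, 2, by simp [word, xk, hc1, hi2]⟩
  · exact ⟨1, 6, by simp [word, xk, hc1, hi2, mul_assoc]⟩
  · exact ⟨1, 1, by simp [word, xk, hc1, hi3]⟩
  · exact ⟨1, 5, by simp [word, xk, hc1, hi3, mul_assoc]⟩
  · exact ⟨1, 3, by simp [word, xk, hc1, hi3, mul_assoc]⟩
  · exact ⟨1, 7, by simp [word, xk, hc1, hi3, mul_assoc]⟩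

omit [DecidableEq G] in
/-- **EXHAUSTION: every element is a word.** [folklore] -/
theorem exists_word (g : G) : ∃ (e : ZMod 2) (v : Fin 8), g = word D e v := by
  obtain ⟨u, hu, v, hv, d, hd, rfl⟩ := D.exhaust g
  obtain ⟨e, w, h⟩ := exists_word_eq D u v d hu hv hd
  exact ⟨e, w, h⟩

omit [DecidableEq G] in
/-- **The word map is a bijection** `ℤ/2 × Fin 8 → G`. [folklore] -/
theorem word_bijective : Function.Bijective fun t : ZMod 2 × Fin 8 => word D t.1 t.2 := by
  classical
  rw [Fintype.bijective_iff_surjective_and_card]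
  refine ⟨fun g => ?_, by simp [D.card_eq]⟩
  obtain ⟨e, v, rfl⟩ := exists_word D g
  exact ⟨(e, v), rfl⟩

/-- **Words as an equivalence** `ℤ/2 × Fin 8 ≃ G`. [folklore] -/
def wordEquiv : ZMod 2 × Fin 8 ≃ G := Equiv.ofBijective _ (word_bijective D)

omit [DecidableEq G] in
/-- `wordEquiv (e, v) = word e v`. [folklore] -/
@[simp] theorem wordEquiv_apply (t : ZMod 2 × Fin 8) : wordEquiv D t = word D t.1 t.2 := rfl

omit [DecidableEq G] in
/-- `wordEquiv⁻¹ (word e v) = (e, v)`. [folklore] -/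
@[simp] theorem wordEquiv_symm_word (e : ZMod 2) (v : Fin 8) : (wordEquiv D).symm (word D e v) = (e, v) :=
  (wordEquiv D).injective (by rw [Equiv.apply_symm_apply, wordEquiv_apply])

omit [DecidableEq G] in
/-- **Words are unique.** [folklore] -/
theorem word_eq_word_iff (e e' : ZMod 2) (v v' : Fin 8) : word D e v = word D e' v' ↔ e = e' ∧ v = v' := by
  constructor
  · intro h
    have := (word_bijective D).1 (a₁ := (e, v)) (a₂ := (e', v')) h
    exact ⟨(Prod.mk.inj this).1, (Prod.mk.inj this).2⟩
  · rintro ⟨rfl, rfl⟩; rfl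

/-- **The place of a word**: `word e' v' ∈ {word e v, c·word e v}` iff `v' = v`. [folklore] -/
theorem word_mem_orb_word_iff (e e' : ZMod 2) (v v' : Fin 8) : word D e' v' ∈ orb c (word D e v) ↔ v' = v := by
  rw [mem_orb, c_mul_word, word_eq_word_iff, word_eq_word_iff]
  constructor
  · rintro (⟨-, h⟩ | ⟨-, h⟩) <;> exact h
  · rintro rfl
    have h01 : ∀ z w : ZMod 2, z = w ∨ z = w + 1 := by decide
    rcases h01 e' e with h | h
    · exact Or.inl ⟨h, rfl⟩
    · exact Or.inr ⟨h, rfl⟩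

/-! ## §2 The dictionary -/

/-- **The label of an abstract CM type**: coordinate `v` is `0` if `word 0 v ∈ Ψ`, else `1`. [folklore] -/
def ty (Ψ : CMF G c) : Lab := fun v => if word D 0 v ∈ Ψ.1 then 0 else 1

/-- `ℤ/2` has two elements. [folklore] -/
private theorem zmod2_cases : ∀ e : ZMod 2, e = 0 ∨ e = 1 := by decide

/-- **`word e v ∈ Ψ ↔ ty Ψ v = e`.** [folklore] -/
theorem word_mem_iff (Ψ : CMF G c) (e : ZMod 2) (v : Fin 8) : word D e v ∈ Ψ.1 ↔ ty D Ψ v = e := by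
  unfold ty
  have hcm : word D 1 v ∈ Ψ.1 ↔ word D 0 v ∉ Ψ.1 := by
    have h := Ψ.2 (word D 0 v)
    rw [c_mul_word, zero_add] at h
    tauto
  rcases zmod2_cases e with rfl | rfl
  · by_cases h : word D 0 v ∈ Ψ.1 <;> simp [h]
  · rw [hcm]; by_cases h : word D 0 v ∈ Ψ.1 <;> simp [h]

/-- The underlying set of the abstract CM type of a label. [folklore] -/
def typeSetOf (Θ : Lab) : Finset G := univ.filter fun g => Θ ((wordEquiv D).symm g).2 = ((wordEquiv D).symm g).1

omit [DecidableEq G] in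
/-- Membership of a word in the set of a label. [folklore] -/
theorem word_mem_typeSetOf (Θ : Lab) (e : ZMod 2) (v : Fin 8) : word D e v ∈ typeSetOf D Θ ↔ Θ v = e := by
  simp only [typeSetOf, mem_filter, mem_univ, true_and, wordEquiv_symm_word]

/-- The CM-type axiom in `ℤ/2`. [folklore] -/
private theorem eq_iff_not_eq_add_one : ∀ u e : ZMod 2, u = e ↔ ¬ u = e + 1 := by decide

omit [DecidableEq G] in
/-- The set of a label is an abstract CM type. [folklore] -/
theorem isCMF_typeSetOf (Θ : Lab) : IsCMF c (typeSetOf D Θ) := by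
  intro g
  obtain ⟨e, v, rfl⟩ := exists_word D g
  rw [c_mul_word, word_mem_typeSetOf, word_mem_typeSetOf]
  exact eq_iff_not_eq_add_one _ _

/-- **The abstract CM type of a label.** [folklore] -/
def typeOf (Θ : Lab) : CMF G c := ⟨typeSetOf D Θ, isCMF_typeSetOf D Θ⟩

/-- `ty ∘ typeOf = id`. [folklore] -/
theorem ty_typeOf (Θ : Lab) : ty D (typeOf D Θ) = Θ := by
  funext v
  have h := word_mem_typeSetOf D Θ (Θ v) v
  exact (word_mem_iff D (typeOf D Θ) (Θ v) v).mp (h.mpr rfl)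

/-- `typeOf ∘ ty = id`. [folklore] -/
theorem typeOf_ty (Ψ : CMF G c) : typeOf D (ty D Ψ) = Ψ := by
  apply Subtype.ext
  ext g
  obtain ⟨e, v, rfl⟩ := exists_word D g
  exact (word_mem_typeSetOf D _ e v).trans (word_mem_iff D Ψ e v).symm

/-- **THE DICTIONARY**: abstract CM types of `(G, c)` ≃ labels. [folklore] -/
def typeEquiv : CMF G c ≃ Lab where
  toFun := ty D
  invFun := typeOf D
  left_inv := typeOf_ty D
  right_inv := ty_typeOf D

/-- `ty` is injective. [folklore] -/
theorem ty_injective : Function.Injective (ty (c := c) D) := (typeEquiv D).injective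

/-! ## §3 Base changes are the motions -/

/-- The indicator of an equation in `ℤ/2`: `[x = m] = x + m` (as `0`/`1`). [folklore] -/
private theorem ite_eq_add : ∀ y m : ZMod 2, (if y = m then (0 : ZMod 2) else 1) = y + m := by decide

/-- The label of a base change reads the moved word. [folklore] -/
theorem ty_rt_apply (Q : G) (Ψ : CMF G c) (v : Fin 8) : ty D (rt c Q Ψ) v = if word D 0 v * Q ∈ Ψ.1 then 0 else 1 := by
  unfold ty; simp only [mem_rt]

/-- **Base change along `i` is the motion `μI τ`.** [folklore] -/
theorem ty_rt_i (Ψ : CMF G c) : ty D (rt c D.i Ψ) = μI τ (ty D Ψ) := by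
  funext v
  rw [ty_rt_apply, word_mul_i]
  simp only [word_mem_iff, zero_add, ite_eq_add, μI_apply]

/-- **Base change along `j` is the motion `μJ τ`.** [folklore] -/
theorem ty_rt_j (Ψ : CMF G c) : ty D (rt c D.j Ψ) = μJ τ (ty D Ψ) := by
  funext v
  rw [ty_rt_apply, word_mul_j]
  simp only [word_mem_iff, zero_add, ite_eq_add, μJ_apply]

/-- **Base change along `x` is the motion `μX`.** [folklore] -/
theorem ty_rt_x (Ψ : CMF G c) : ty D (rt c D.x Ψ) = μX (ty D Ψ) := by
  funext v
  rw [ty_rt_apply, word_mul_x]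
  simp only [word_mem_iff, μX_apply]
  rcases zmod2_cases (ty D Ψ (πX v)) with h | h <;> simp [h]

/-- **Base change along `c` is the complement `μC`.** [folklore] -/
theorem ty_rt_c (Ψ : CMF G c) : ty D (rt c c Ψ) = μC (ty D Ψ) := by
  funext v
  rw [ty_rt_apply, word_mul_c]
  simp only [word_mem_iff, zero_add, ite_eq_add, μC_apply]

/-- **The group word** `cᵉ iᵃ jᵇ xᵈ` of `w = e + 2a + 4b + 8d`. [folklore] -/
def wordG (w : Fin 16) : G := c ^ (w.val % 2) * D.i ^ (w.val / 2 % 2) * D.j ^ (w.val / 4 % 2) * D.x ^ (w.val / 8 % 2)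

/-- Base change along `gⁿ` (`n < 2`) iterates the motion of `g`. [folklore] -/
theorem ty_rt_pow (g : G) (μ : Lab → Lab) (hμ : ∀ Ψ, ty D (rt c g Ψ) = μ (ty D Ψ)) {n : ℕ} (hn : n < 2) (Ψ : CMF G c) :
    ty D (rt c (g ^ n) Ψ) = μ^[n] (ty D Ψ) := by
  interval_cases n
  · rw [pow_zero, rt_one]; rfl
  · rw [pow_one, hμ]; rfl

/-- **Base change along a group word is the word motion.** [folklore] -/
theorem ty_rt_wordG (w : Fin 16) (Ψ : CMF G c) : ty D (rt c (wordG D w) Ψ) = Motw τ w (ty D Ψ) := by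
  rw [wordG, rt_mul, rt_mul, rt_mul, Motw,
    ty_rt_pow D c μC (ty_rt_c D) (Nat.mod_lt _ (by norm_num)),
    ty_rt_pow D D.i (μI τ) (ty_rt_i D) (Nat.mod_lt _ (by norm_num)),
    ty_rt_pow D D.j (μJ τ) (ty_rt_j D) (Nat.mod_lt _ (by norm_num)),
    ty_rt_pow D D.x μX (ty_rt_x D) (Nat.mod_lt _ (by norm_num))]

/-- The `typeOf` form: `typeOf (Motw τ w Θ) = (typeOf Θ)·(wordG w)⁻¹`. [folklore] -/
theorem typeOf_Motw (w : Fin 16) (Θ : Lab) : typeOf D (Motw τ w Θ) = rt c (wordG D w) (typeOf D Θ) := by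
  apply ty_injective D; rw [ty_rt_wordG, ty_typeOf, ty_typeOf]

/-! ## §4 Flips -/

/-- **Flipping at the place of `word e v` flips the label at `v`.** [folklore] -/
theorem ty_oflipCM_word (e : ZMod 2) (v : Fin 8) (Φ : CMF G c) : ty D (oflipCM c D.c_mul_c (word D e v) Φ) = flipAt v (ty D Φ) := by
  funext v'
  rw [flipAt_apply]
  unfold ty
  have hmem : word D 0 v' ∈ (oflipCM c D.c_mul_c (word D e v) Φ).1 ↔ (word D 0 v' ∈ Φ.1 ↔ ¬ v' = v) := by
    show word D 0 v' ∈ oflip c (word D e v) Φ.1 ↔ _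
    rw [oflip, Finset.mem_symmDiff, word_mem_orb_word_iff]
    tauto
  simp only [hmem]
  by_cases hv : v' = v
  · simp only [hv, not_true_eq_false, iff_false, if_true]
    by_cases h : word D 0 v ∈ Φ.1
    · simp [h]
    · simp only [h, not_false_eq_true, if_true, if_false]; decide
  · simp [hv]

/-- The `typeOf` form: `typeOf (flipAt v Θ) = (typeOf Θ)^{(word e v)}`. [folklore] -/
theorem typeOf_flipAt (e : ZMod 2) (v : Fin 8) (Θ : Lab) : typeOf D (flipAt v Θ) = oflipCM c D.c_mul_c (word D e v) (typeOf D Θ) := by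
  apply ty_injective D; rw [ty_oflipCM_word, ty_typeOf, ty_typeOf]

end

end Summit.HodgeConjecture.CorCM.Census.QuaternionDoubling
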